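import Mathlib
import Summits.Ventures.PercRepro.TriangleCapRowA1CapRefMain
import Summits.Ventures.PercRepro.TriangleCapRowA2CapCount

/-!
# PercRepro — THE CAP ON THE CELL `(k, a, a + 2)` FOR EVERY ROW `a ≥ 7`, `k ≥ 3a + 2`: a `K₄⁻`-free graph with
`a (k − a) − (a + 2)` edges and a vertex of degree `k − a` is `a`-bipartite or at least `2k + 2a − 14` below the
closed form — the triple-broom gap (p3, gen 47; part 200zl)

The skeleton of part 200y with the counts of part 200zk (`E = 0` for `K ≥ 2a + 2`, `M ≤ 1` for `a ≥ 7`) and the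
deficit-`4` accounting of part 200zj; the `K₄⁻` lemmas `rowA1_nonend_miss` / `rowA1_ends_miss` are those of part
200y (they do not see the deficit). Slack `2a − 12`. The rows `a ∈ {5, 6}` (a matching of size `2` is allowed) and
the corner `k = 3a + 1` are left to the row of `r = a + 2` (§10cf). Axioms: standard.
-/

namespace PercRepro

namespace TriangleCap

namespace C047

open Finset

variable {V : Type*} [Fintype V] [DecidableEq V]

/-- **THE CAP ON THE CELL `(k, a, a + 2)`, `a ≥ 7`, `k ≥ 3a + 2`:** a `K₄⁻`-free graph with `a (k − a) − (a + 2)`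
edges and a vertex `x` of degree `k − a` is a spanning subgraph of some `K(A, Aᶜ)` with `|A| = a`, or
`Σ_v d(v)² + (a + 2)(k − 1 − (a + 2)) + (2k + 2a − 14) ≤ m k` (the triple-broom gap). -/
theorem cap_A2_gen (D : SimpleGraph V) [DecidableRel D.Adj] (hK : K4mFree D) (a : ℕ) (ha7 : 7 ≤ a)
    (hk : 3 * a + 2 ≤ Fintype.card V) (hm : D.edgeFinset.card + (a + 2) = a * (Fintype.card V - a)) (x : V)
    (hx : deg D x + a = Fintype.card V) :
    (∃ A : Finset V, A.card = a ∧ BipSub D A) ∨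
      ∑ v, deg D v * deg D v + (a + 2) * (Fintype.card V - 1 - (a + 2)) + (2 * Fintype.card V + 2 * a - 14) ≤
        D.edgeFinset.card * Fintype.card V := by
  obtain ⟨N, hN⟩ : ∃ N : Finset V, N = univ.filter (fun w => D.Adj x w) := ⟨_, rfl⟩
  have hmemN : ∀ w, w ∈ N ↔ D.Adj x w := fun w => by rw [hN, mem_filter]; simp only [mem_univ, true_and]
  have hxN : x ∉ N := fun h => D.irrefl ((hmemN x).mp h)
  have hdx : deg D x = N.card := by rw [hN]; rfl
  obtain ⟨K, hKdef⟩ : ∃ K, N.card = K := ⟨_, rfl⟩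
  have hcardV : Fintype.card V = K + a := by omega
  obtain ⟨m, hmdef⟩ : ∃ m, D.edgeFinset.card = m := ⟨_, rfl⟩
  have hcap : ∀ v, deg D v + a ≤ Fintype.card V := fun v =>
    deg_add_le_card_of_dense D hK a (by omega) (by omega)
      (cap_arith a (Fintype.card V) D.edgeFinset.card (a + 2) (by omega) (by omega)
        (below_cap_arith a (Fintype.card V) D.edgeFinset.card (a + 2) (by omega) hm)) v
  rw [hmdef, hcardV, Nat.add_sub_cancel] at hm
  obtain ⟨R, hR⟩ : ∃ R : Finset V, R = (insert x N)ᶜ := ⟨_, rfl⟩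
  have hRcard : R.card + 1 = a := by
    rw [hR, card_compl, card_insert_of_notMem hxN]
    omega
  have hmemR : ∀ w, w ∈ R ↔ w ≠ x ∧ ¬ D.Adj x w := by
    intro w
    rw [hR, mem_compl, mem_insert, hmemN]
    tauto
  obtain ⟨M, hM⟩ : ∃ M, adjPairs D N = 2 * M := ⟨_, adjPairs_eq_two_mul D N⟩
  have hTf : ∑ y ∈ N, degIn D N y = 2 * M := by rw [← adjPairs_eq_sum_degIn, hM]
  obtain ⟨P, hPdef⟩ : ∃ P, ∑ u ∈ R, degIn D N u = P := ⟨_, rfl⟩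
  obtain ⟨E, hEdef⟩ : ∃ E, adjPairs D R = E := ⟨_, rfl⟩
  have hsplit : ∀ F : V → ℕ, ∑ w, F w = F x + ∑ y ∈ N, F y + ∑ u ∈ R, F u := by
    intro F
    rw [← sum_add_sum_compl (insert x N), sum_insert hxN, ← hR]
  have hdegN : ∀ y ∈ N, deg D y = 1 + degIn D N y + degIn D R y := by
    intro y hy
    have := deg_eq_of_mem_nbhd D x y ((hmemN y).mp hy)
    rw [← hN, ← hR] at this
    exact this
  have hsumN : ∑ y ∈ N, deg D y = K + 2 * M + P := by
    rw [sum_congr rfl hdegN, sum_add_distrib, sum_add_distrib, sum_const, smul_eq_mul, mul_one, hKdef, hTf,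
      sum_degIn_comm D N R, hPdef]
  have hdegR : ∀ u ∈ R, deg D u = degIn D N u + degIn D R u := by
    intro u hu
    have := deg_eq_of_not_mem_nbhd D x u ((hmemR u).mp hu).2
    rw [← hN, ← hR] at this
    exact this
  have hsumR : ∑ u ∈ R, deg D u = P + E := by
    rw [sum_congr rfl hdegR, sum_add_distrib, hPdef, ← adjPairs_eq_sum_degIn, hEdef]
  have hdegsum := sum_deg_eq D
  rw [hsplit, hsumN, hsumR, hdx, hKdef, hmdef] at hdegsum
  have hcapK : ∀ u ∈ R, deg D u ≤ K := fun u _ => by have := hcap u; omega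
  have h1 : P + E ≤ (a - 1) * K := by
    rw [← hsumR]
    calc ∑ u ∈ R, deg D u ≤ ∑ _u ∈ R, K := sum_le_sum (fun u hu => hcapK u hu)
      _ = (a - 1) * K := by rw [sum_const, smul_eq_mul]; congr 1; omega
  have hPle : ∀ u ∈ R, degIn D N u + M ≤ K := by
    intro u hu
    have := two_mul_degIn_add_adjPairs_le D hK (x := x) ((hmemR u).mp hu).1
    rw [← hN, hM, hKdef] at this
    omega
  have h2 : P + (a - 1) * M ≤ (a - 1) * K := by
    have hs : ∑ u ∈ R, (degIn D N u + M) ≤ ∑ _u ∈ R, K := sum_le_sum hPle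
    rw [sum_add_distrib, sum_const, sum_const, smul_eq_mul, smul_eq_mul, hPdef] at hs
    have e : R.card = a - 1 := by omega
    rw [e] at hs
    exact hs
  obtain ⟨a', rfl⟩ : ∃ a', a = a' + 5 := ⟨a - 5, by omega⟩
  have e1 : a' + 5 - 1 = a' + 4 := by omega
  rw [e1] at h1 h2
  -- no edge inside `R`
  have hE0 : E = 0 := by
    by_contra hE
    obtain ⟨u, hu, hu1⟩ : ∃ u ∈ R, 1 ≤ degIn D R u := by
      by_contra hcon
      push Not at hcon
      have h0 : ∑ u ∈ R, degIn D R u = 0 := sum_eq_zero (fun u hu => by have := hcon u hu; omega)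
      rw [← adjPairs_eq_sum_degIn, hEdef] at h0
      exact hE h0
    obtain ⟨v, hv, huv⟩ : ∃ v ∈ R, D.Adj u v := by
      unfold degIn at hu1
      obtain ⟨v, hv⟩ := card_pos.mp hu1
      rw [mem_filter] at hv
      exact ⟨v, hv.1, hv.2⟩
    have hne : u ≠ v := D.ne_of_adj huv
    have hPuv : degIn D N u + degIn D N v ≤ K + 1 := by
      have := degIn_add_degIn_le_of_adj_pair D hK N huv
      rw [hKdef] at this
      exact this
    have hvR' : v ∈ R.erase u := mem_erase.mpr ⟨hne.symm, hv⟩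
    have hsum1 := add_sum_erase R (fun w => degIn D N w) hu
    have hsum2 := add_sum_erase (R.erase u) (fun w => degIn D N w) hvR'
    have hsum1' := add_sum_erase R (fun w => degIn D R w) hu
    have hsum2' := add_sum_erase (R.erase u) (fun w => degIn D R w) hvR'
    have hcard2 : ((R.erase u).erase v).card = a' + 2 := by
      rw [card_erase_of_mem hvR', card_erase_of_mem hu]
      omega
    have hrest : ∑ w ∈ (R.erase u).erase v, degIn D N w + (a' + 2) * M ≤ (a' + 2) * K := by
      have hs : ∑ w ∈ (R.erase u).erase v, (degIn D N w + M) ≤ ∑ _w ∈ (R.erase u).erase v, K :=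
        sum_le_sum (fun w hw => hPle w (mem_of_mem_erase (mem_of_mem_erase hw)))
      rw [sum_add_distrib, sum_const, sum_const, smul_eq_mul, smul_eq_mul, hcard2] at hs
      exact hs
    have hr : ∑ w ∈ (R.erase u).erase v, degIn D N w + ∑ w ∈ (R.erase u).erase v, degIn D R w ≤ (a' + 2) * K := by
      rw [← sum_add_distrib]
      calc ∑ w ∈ (R.erase u).erase v, (degIn D N w + degIn D R w)
          = ∑ w ∈ (R.erase u).erase v, deg D w :=
            sum_congr rfl (fun w hw => (hdegR w (mem_of_mem_erase (mem_of_mem_erase hw))).symm)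
        _ ≤ ∑ _w ∈ (R.erase u).erase v, K :=
            sum_le_sum (fun w hw => hcapK w (mem_of_mem_erase (mem_of_mem_erase hw)))
        _ = (a' + 2) * K := by rw [sum_const, smul_eq_mul, hcard2]
    have hu' : degIn D N u + degIn D R u ≤ K := by rw [← hdegR u hu]; exact hcapK u hu
    have hv' : degIn D N v + degIn D R v ≤ K := by rw [← hdegR v hv]; exact hcapK v hv
    have hdu : degIn D R u ≤ a' + 3 := by
      have := degIn_le_card_erase D R u
      rw [card_erase_of_mem hu] at this
      omega
    have hdv : degIn D R v ≤ a' + 3 := by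
      have := degIn_le_card_erase D R v
      rw [card_erase_of_mem hv] at this
      omega
    have hEsum : E = degIn D R u + (degIn D R v + ∑ w ∈ (R.erase u).erase v, degIn D R w) := by
      rw [← hEdef, adjPairs_eq_sum_degIn, ← hsum1', ← hsum2']
    have hPsum : P = degIn D N u + (degIn D N v + ∑ w ∈ (R.erase u).erase v, degIn D N w) := by
      rw [← hPdef, ← hsum1, ← hsum2]
    have hm7 : m + (a' + 7) = (a' + 5) * K := by omega
    exact rowA2_noedge a' K M P E m _ _ _ _ _ _ (by omega) hdegsum hm7 h1 hPuv hrest (by rw [hPsum]; ring)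
      (by rw [hEsum]; ring) hu' hv' hr hdu hdv
  have hM2' := rowA2_matching a' K M P m (by rw [hE0] at hdegsum; exact hdegsum) hm h2
  have hnoR : ∀ u ∈ R, degIn D R u = 0 := by
    intro u hu
    have hle : degIn D R u ≤ ∑ z ∈ R, degIn D R z := single_le_sum (fun _ _ => Nat.zero_le _) hu
    rw [← adjPairs_eq_sum_degIn, hEdef, hE0] at hle
    exact Nat.le_zero.mp hle
  rcases Nat.eq_zero_or_pos M with hM0 | hMpos
  · left
    have hnoN : ∀ y ∈ N, ∀ y', D.Adj y y' → y' ∉ N := by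
      intro y hy y' hyy' hy'
      have h0 : degIn D N y = 0 := by
        have hle : degIn D N y ≤ ∑ z ∈ N, degIn D N z := single_le_sum (fun _ _ => Nat.zero_le _) hy
        rw [hTf, hM0, mul_zero] at hle
        exact Nat.le_zero.mp hle
      unfold degIn at h0
      rw [card_eq_zero, filter_eq_empty_iff] at h0
      exact h0 hy' hyy'
    have hnoR' : ∀ u ∈ R, ∀ u', D.Adj u u' → u' ∉ R := by
      intro u hu u' huu' hu'
      have h0 := hnoR u hu
      unfold degIn at h0
      rw [card_eq_zero, filter_eq_empty_iff] at h0
      exact h0 hu' huu'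
    refine ⟨Nᶜ, ?_, ?_⟩
    · rw [card_compl, hKdef]
      omega
    · intro p q hpq
      rw [mem_compl, mem_compl, not_not]
      constructor
      · intro hpN
        by_contra hqN
        by_cases hpx : p = x
        · subst hpx
          exact hqN ((hmemN q).mpr hpq)
        by_cases hqx : q = x
        · subst hqx
          exact hpN ((hmemN p).mpr (D.adj_symm hpq))
        have hpR : p ∈ R := (hmemR p).mpr ⟨hpx, fun h => hpN ((hmemN p).mpr h)⟩
        have hqR : q ∈ R := (hmemR q).mpr ⟨hqx, fun h => hqN ((hmemN q).mpr h)⟩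
        exact hnoR' p hpR q hpq hqR
      · intro hqN hpN
        exact hnoN p hpN q hpq hqN
  · right
    have hM1'' : M = 1 := by
      have := hM2'.2
      omega
    subst hM1''
    have hP : P + (a' + 5 + 3) + K = (a' + 5) * K := by omega
    have hPle' : ∀ u ∈ R, degIn D N u + 1 ≤ K := hPle
    have hsumR' : ∑ u ∈ R, degIn D N u + 4 = R.card * (K - 1) := by
      rw [hPdef]
      have e : R.card = a' + 4 := by omega
      rw [e]
      obtain ⟨K', rfl⟩ : ∃ K', K = K' + 1 := ⟨K - 1, by omega⟩
      rw [Nat.add_sub_cancel]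
      nlinarith [hP]
    obtain ⟨np, hnp⟩ : ∃ np, (R.filter (fun u => degIn D N u + 2 ≤ K)).card = np := ⟨_, rfl⟩
    have hnp4 : np ≤ 4 := by
      rw [← hnp]
      exact rowA2_np_le_four D R N K hPle' hsumR'
    have hSR := rowA2_R_sum_ref D R N K hPle' hsumR'
    rw [hnp] at hSR
    have hdegRu : ∀ t ∈ R, deg D t = degIn D N t := fun t ht => by
      rw [hdegR t ht, hnoR t ht, add_zero]
    have hSR' : ∑ u ∈ R, deg D u * deg D u + 8 * (K - 1) + 4 * np ≤ (a' + 5 - 1) * ((K - 1) * (K - 1)) + 20 := by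
      rw [sum_congr rfl (fun t ht => by rw [hdegRu t ht])]
      have e : R.card = a' + 5 - 1 := by omega
      rw [← e]
      exact hSR
    have hfg_le : 2 * ∑ y ∈ N, degIn D N y * degIn D R y ≤ 2 * (a' + 4) := by
      have := two_mul_sum_degIn_mul_degIn_le D hK x R (fun u hu => ((hmemR u).mp hu).1)
      rw [← hN, hM] at this
      have e : R.card = a' + 4 := by omega
      rw [e] at this
      omega
    have hf1 : ∀ y ∈ N, degIn D N y ≤ 1 := fun y hy => by
      have h1 := degIn_nbhd_le_one D hK (x := x) (u := y) ((hmemN y).mp hy)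
      rw [← hN] at h1
      exact h1
    have hfg_le' : 2 * ∑ y ∈ N, degIn D N y * degIn D R y ≤ 2 * (a' + 5 - 1) := by
      have e : a' + 5 - 1 = a' + 4 := by omega
      rw [e]
      exact hfg_le
    -- the triangle edge `y₁ y₂` of `N`
    obtain ⟨y₁, hy₁N, hy₁pos⟩ : ∃ y₁ ∈ N, 1 ≤ degIn D N y₁ := by
      by_contra hcon
      push Not at hcon
      have h0 : ∑ y ∈ N, degIn D N y = 0 := sum_eq_zero (fun y hy => by have := hcon y hy; omega)
      rw [hTf] at h0
      omega
    obtain ⟨y₂, hy₂N, h12⟩ : ∃ y₂ ∈ N, D.Adj y₁ y₂ := by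
      unfold degIn at hy₁pos
      obtain ⟨y₂, hy₂⟩ := card_pos.mp hy₁pos
      rw [mem_filter] at hy₂
      exact ⟨y₂, hy₂.1, hy₂.2⟩
    have hmissR : ∀ y, a' + 5 - 1 - degIn D R y = (R.filter (fun u => ¬ D.Adj y u)).card := fun y => by
      have h := card_filter_add_card_filter_not (s := R) (fun u => D.Adj y u)
      unfold degIn
      omega
    have hNE : ∀ y ∈ N, degIn D N y = 0 → a' + 5 - 1 - degIn D R y ≤ np := by
      intro y hy hy0
      rw [hmissR y, ← hnp]
      apply card_le_card
      intro u hu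
      rw [mem_filter] at hu
      rw [mem_filter]
      refine ⟨hu.1, ?_⟩
      rw [← hKdef]
      exact rowA1_nonend_miss D hK x N hmemN y₁ y₂ hy₁N hy₂N h12 y hy hy0 u ((hmemR u).mp hu.1).1
        (fun h => hu.2 (D.adj_symm h))
    have hE2 : ∀ z₁ ∈ N, ∀ z₂ ∈ N, z₁ ≠ z₂ → degIn D N z₁ = 1 → degIn D N z₂ = 1 →
        (a' + 5 - 1 - degIn D R z₁) + (a' + 5 - 1 - degIn D R z₂) ≤ (a' + 5 - 1) + np := by
      intro z₁ hz₁ z₂ hz₂ hne _ _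
      rw [hmissR z₁, hmissR z₂]
      have h := rowA1_ends_miss D R N z₁ z₂ hz₁ hz₂ hne
      rw [hKdef, hnp] at h
      omega
    have hSN := rowA2_N_sum_ref D N R K (a' + 5) P np (by omega) hKdef (by omega) hdegN hf1 (by rw [hTf])
      (by rw [sum_degIn_comm D N R]; exact hPdef) hfg_le' hP hNE hE2
    rw [hsplit (fun v => deg D v * deg D v), hdx, hKdef, hmdef, hcardV]
    exact rowA2_sq_arith_ref (a' + 5) K P _ _ np m (by omega) hnp4 (by omega) hm hP hSN hSR'

end C047

end TriangleCap

end PercRepro
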